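import Literature.MathematicalPhysics.QuantumLattice.SpinChains
import Literature.MathematicalPhysics.QuantumLattice.LiebMattisSectorPF
import HarnessLib

/-!
# Discharged fact: the Lieb–Mattis theorem on the spin of the ground state (`marshall_lieb_mattis_spin`)

Sibling proof file of `Literature/MathematicalPhysics/QuantumLattice/SpinChains.lean` (theorems
only; no statement or definition is introduced or changed). It discharges the named fact
(`def X : Prop`, D-0014)

* `Literature.MathematicalPhysics.QuantumLattice.marshall_lieb_mattis_spin` — for the spin-`n/2`
  Heisenberg antiferromagnet `H = J Σ_{{x,y} ∈ E(G)} 𝐒_x · 𝐒_y`, `J > 0`, on a finite connected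
  graph bipartite in `A`, `Aᶜ`, every ground state has total spin `S₀ = |(|A| - |Aᶜ|)| n/2`
  (`(𝐒_tot)² ψ = S₀(S₀+1) ψ`) and the ground-state degeneracy is exactly `2S₀ + 1`
  (`marshall_lieb_mattis_spin_holds`).

(The companion facts `marshall_lieb_mattis_unique` and `lieb_mattis_monotone` are discharged in
`SpinChainsMarshallLiebMattisProofs.lean` and `SpinChainsLiebMattisProofs.lean`, by other hands,
partly on top of `LiebMattisMatrixElements.lean`; the present development is independent of them.)

## Source

E. H. Lieb, D. C. Mattis, *Ordering energy levels of interacting spin systems*, J. Math. Phys.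
**3** (1962) 749–751, Theorem 2 (`E(S+1) > E(S)` for `S ≥ 𝒮 = |S_A - S_B|`, and the ground state
of the bipartite antiferromagnet belongs to `S = 𝒮` and is nondegenerate apart from the
`(2𝒮+1)`-fold spin degeneracy) and its proof (Marshall signs, Perron–Frobenius in each `M`
subspace, identification of the spin by a positive reference state); W. Marshall, Proc. Roy. Soc.
A **232** (1955) 48; H. Tasaki, *Physics and Mathematics of Quantum Many-Body Systems* (2020),
§2.4, Theorem 2.3 (Marshall–Lieb–Mattis theorem); D. C. Mattis, *The Theory of Magnetism Made
Simple* (2006), §5.10, pp. 230–231 (`S_T = |N_A s_A - N_B s_B|`).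

## Proof (with the sibling files `LiebMattisLadder`, `LiebMattisMatrixElements`, `LiebMattisSectorPF`)

Weights `W(σ) = Σ_x σ_x` label the `Ŝᶻ` sectors (`M = |Λ| n/2 - W`). By symmetry `A ↔ Aᶜ` assume
`|Aᶜ| ≤ |A|`; put `N₀ = |Aᶜ| n`, `N₁ = |A| n` (magnetisations `±S₀`). Perron–Frobenius in each
sector (Marshall-conjugated `H` has nonpositive off-diagonal entries and a connected graph) gives a
unique, Marshall-positive sector ground state `ψ_W`, an eigenvector of `(𝐒_tot)²`. The valence-bond
reference vector shows `(𝐒_tot)² ψ_{N₀} = S₀(S₀+1) ψ_{N₀}`; test configurations show `Ŝ⁺ψ_W ≠ 0`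
for `W > N₀`, whence `E(W-1) ≤ E(W)` there, while `SU(2)` lowering gives `E(W+1) ≤ E(W)` for
`M > 0`; so `E(N₀) = E₀`. Lowering `ψ_W` step by step (it is never a lowest-weight vector, its
`(𝐒_tot)²` eigenvalue being `S₀(S₀+1) ≠ M(M-1)`) gives `E(W) = E₀` and eigenvalue `S₀(S₀+1)` for
`N₀ ≤ W ≤ N₁`; outside this range `E(W) = E₀` would transport an eigenvalue `≥ |M|(|M|+1) > S₀(S₀+1)`
to `W = N₀` or `N₁`. Hence the ground space is `⊕_{N₀ ≤ W ≤ N₁} ℂ ψ_W`: dimension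
`N₁ - N₀ + 1 = 2S₀ + 1`, contained in the `S₀(S₀+1)` eigenspace of `(𝐒_tot)²`. No new facts are
introduced (net debt delta `-1`).

Contents of this file: Part 1 — the valence-bond **reference vector** (pair every site of `Aᶜ`
with a distinct site of `A` in the two-spin singlet `Σ_k (-1)^k |k⟩_A |n-k⟩_{Aᶜ}`, unpaired sites
of `A` fully up; it lies in the sector of weight `|Aᶜ| n`, is annihilated by `Ŝ⁺_tot`, and its
coefficients are `0` or the Marshall sign, so a Marshall-positive vector of that sector has
`(𝐒_tot)² = S₀(S₀+1)` — this replaces the comparison with the soluble model `𝐒_A · 𝐒_B` of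
Lieb–Mattis) and the **test configurations** (a Marshall-positive vector of weight `> |Aᶜ| n` is
not highest weight); Part 2 — **ordering of the sector energies** (transfer lemmas between
neighbouring sectors, `E(W) ≤ E(W+1)` for `W ≥ |Aᶜ| n`, `E(W+1) ≤ E(W)` for `2W < |Λ| n`,
`E(|Aᶜ| n) = E₀`); Part 3 — the sectors `|Aᶜ| n ≤ W ≤ |A| n` and the discharge.
-/

noncomputable section

open Matrix Complex Finset

namespace Literature.MathematicalPhysics.QuantumLattice

namespace LiebMattis

open EigenvalueContinuation

section QLattice

variable {Λ : Type*} [Fintype Λ] [DecidableEq Λ] (n : ℕ)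

/-! ### Configurations with a frozen part -/

/-- **Configurations of prescribed weight with a frozen part**: for every `T ≤ |Pᶜ| n` there is
a configuration equal to `k` on `P` whose labels on `Pᶜ` add up to `T`. [folklore] -/
theorem exists_config (P : Finset Λ) (k : Fin (n + 1)) :
    ∀ T : ℕ, T ≤ Pᶜ.card * n →
      ∃ τ : TensorIndex Λ (n + 1), (∀ z ∈ P, τ z = k) ∧ (∑ z ∈ Pᶜ, (τ z : ℕ)) = T := by
  intro T
  induction T with
  | zero =>
    intro _
    refine ⟨fun z => if z ∈ P then k else 0, fun z hz => if_pos hz, ?_⟩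
    exact Finset.sum_eq_zero fun z hz => by simp [Finset.mem_compl.1 hz]
  | succ T ih =>
    intro hT
    obtain ⟨τ, hτP, hτ⟩ := ih (by omega)
    obtain ⟨z, hz, hzn⟩ : ∃ z ∈ Pᶜ, (τ z).val < n := by
      by_contra h
      push Not at h
      have : (∑ z ∈ Pᶜ, (τ z : ℕ)) = Pᶜ.card * n := by
        rw [Finset.card_eq_sum_ones, Finset.sum_mul]
        refine Finset.sum_congr rfl fun z hz => ?_
        have := (τ z).isLt
        have := h z hz
        omega
      omega
    refine ⟨Function.update τ z ⟨(τ z).val + 1, by omega⟩, fun w hw => ?_, ?_⟩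
    · have hwz : w ≠ z := fun h => (Finset.mem_compl.1 hz) (h ▸ hw)
      rw [Function.update_of_ne hwz]
      exact hτP w hw
    · rw [← Finset.add_sum_erase _ _ hz, Function.update_self] at *
      have : ∑ w ∈ Pᶜ.erase z, ((Function.update τ z ⟨(τ z).val + 1, by omega⟩ w : Fin (n + 1)) : ℕ) =
          ∑ w ∈ Pᶜ.erase z, (τ w : ℕ) :=
        Finset.sum_congr rfl fun w hw => by rw [Function.update_of_ne (Finset.ne_of_mem_erase hw)]
      rw [this]
      change (τ z).val + 1 + _ = T + 1
      omega

omit [DecidableEq Λ] in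
/-- The weight of a configuration split along `P`, `Pᶜ`. [folklore] -/
theorem weight_eq_sum_add_sum_compl [DecidableEq Λ] (P : Finset Λ) (τ : TensorIndex Λ (n + 1)) :
    (∑ z, (τ z : ℕ)) = (∑ z ∈ P, (τ z : ℕ)) + ∑ z ∈ Pᶜ, (τ z : ℕ) :=
  (Finset.sum_add_sum_compl P _).symm

/-! ### Single-site increments: weight and Marshall sign -/

omit [DecidableEq Λ] in
/-- Incrementing one label raises the weight by one. [folklore] -/
theorem weight_update_succ [DecidableEq Λ] (τ : TensorIndex Λ (n + 1)) (x : Λ) (l : Fin (n + 1))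
    (hl : (l : ℕ) = (τ x : ℕ) + 1) :
    (∑ z, ((Function.update τ x l z : Fin (n + 1)) : ℕ)) = (∑ z, (τ z : ℕ)) + 1 := by
  rw [← Finset.add_sum_erase _ _ (mem_univ x), ← Finset.add_sum_erase _ _ (mem_univ x),
    Function.update_self, hl]
  have : ∑ z ∈ univ.erase x, ((Function.update τ x l z : Fin (n + 1)) : ℕ) =
      ∑ z ∈ univ.erase x, (τ z : ℕ) :=
    Finset.sum_congr rfl fun z hz => by rw [Function.update_of_ne (Finset.ne_of_mem_erase hz)]
  rw [this]
  ring

omit [Fintype Λ] [DecidableEq Λ] in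
/-- **Incrementing one label flips the Marshall sign iff the site lies in `A`.** Marshall (1955);
Tasaki (2020) §2.4, proof of Thm 2.3. [folklore] -/
theorem marshallSign_update_succ [DecidableEq Λ] (A : Finset Λ) (τ : TensorIndex Λ (n + 1)) (x : Λ)
    (l : Fin (n + 1)) (hl : (l : ℕ) = (τ x : ℕ) + 1) :
    marshallSign A (Function.update τ x l) =
      if x ∈ A then -marshallSign A τ else marshallSign A τ := by
  by_cases hx : x ∈ A
  · rw [if_pos hx, marshallSign, marshallSign, ← Finset.add_sum_erase _ _ hx,
      ← Finset.add_sum_erase _ _ hx, Function.update_self, hl]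
    have : ∑ z ∈ A.erase x, ((Function.update τ x l z : Fin (n + 1)) : ℕ) =
        ∑ z ∈ A.erase x, (τ z : ℕ) :=
      Finset.sum_congr rfl fun z hz => by rw [Function.update_of_ne (Finset.ne_of_mem_erase hz)]
    rw [this, show (τ x : ℕ) + 1 + ∑ z ∈ A.erase x, (τ z : ℕ) =
      ((τ x : ℕ) + ∑ z ∈ A.erase x, (τ z : ℕ)) + 1 by ring, pow_succ]
    ring
  · rw [if_neg hx, marshallSign, marshallSign]
    congr 1
    exact Finset.sum_congr rfl fun z hz => by
      have hzx : z ≠ x := fun h => hx (h ▸ hz)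
      rw [Function.update_of_ne hzx]

/-! ### The valence-bond reference vector -/

/-- **The valence-bond reference vector.** If `|Aᶜ| ≤ |A|`, there is a nonzero vector `v` in the
sector of weight `|Aᶜ| n` (magnetisation `S₀ = (|A| - |Aᶜ|) n/2`) with `Ŝ⁺_tot v = 0` whose
coefficients are `0` or the Marshall sign: `(-1)^{Σ_A σ} v(σ) ∈ {0, 1}`. It is the product of
two-spin singlets `Σ_k (-1)^k |k⟩_{f(y)} ⊗ |n-k⟩_y` over `y ∈ Aᶜ`, `f : Aᶜ ↪ A`, times the fully
polarised state `|0⟩` on the unpaired sites of `A`. Lieb–Mattis (1962), proof of Thm 2 (reference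
state of known spin); Tasaki (2020) §2.5, App. A.3. [folklore] -/
theorem exists_reference_vector (A : Finset Λ) (hcard : Aᶜ.card ≤ A.card) :
    ∃ v : TensorIndex Λ (n + 1) → ℂ, v ≠ 0 ∧
      v ∈ spinZSector (Λ := Λ) n (((Fintype.card Λ * n : ℕ) : ℝ) / 2 - (Aᶜ.card * n : ℕ)) ∧
      (totalSpin n 0 + I • totalSpin n 1 : Op Λ (n + 1)) *ᵥ v = 0 ∧
      ∀ σ, marshallSign A σ * v σ = 0 ∨ marshallSign A σ * v σ = 1 := by
  classical
  -- an injection of the smaller part into the larger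
  have hcard' : Fintype.card (Aᶜ : Finset Λ) ≤ Fintype.card (A : Finset Λ) := by
    simpa only [Fintype.card_coe] using hcard
  obtain ⟨f⟩ := Function.Embedding.nonempty_of_card_le hcard'
  have hfA : ∀ y : (Aᶜ : Finset Λ), ((f y : (A : Finset Λ)) : Λ) ∈ A := fun y => (f y).2
  have hyA : ∀ y : (Aᶜ : Finset Λ), (y : Λ) ∉ A := fun y => Finset.mem_compl.1 y.2
  have hfy : ∀ y y' : (Aᶜ : Finset Λ), ((f y : (A : Finset Λ)) : Λ) ≠ (y' : Λ) :=
    fun y y' h => hyA y' (h ▸ hfA y)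
  -- the support: pairs sum to `n`, unpaired sites of `A` carry `0`
  set Supp : TensorIndex Λ (n + 1) → Prop := fun σ =>
    (∀ y : (Aᶜ : Finset Λ), ((σ (f y : (A : Finset Λ)) : ℕ)) + (σ y : ℕ) = n) ∧
      ∀ x : (A : Finset Λ), (∀ y, f y ≠ x) → (σ x : ℕ) = 0 with hSupp
  set v : TensorIndex Λ (n + 1) → ℂ := fun σ => if Supp σ then marshallSign A σ else 0 with hv
  have hv_apply : ∀ σ, v σ = if Supp σ then marshallSign A σ else 0 := fun σ => rfl
  -- weight of a supported configuration
  have hweight : ∀ σ, Supp σ → (∑ z, (σ z : ℕ)) = Aᶜ.card * n := by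
    intro σ hσ
    rw [weight_eq_sum_add_sum_compl n A, ← Finset.sum_coe_sort A, ← Finset.sum_coe_sort Aᶜ]
    have hsplit : (∑ x : (A : Finset Λ), (σ x : ℕ)) =
        ∑ y : (Aᶜ : Finset Λ), (σ (f y : (A : Finset Λ)) : ℕ) := by
      rw [← Finset.sum_add_sum_compl (univ.map f), Finset.sum_map]
      have h0 : ∑ x ∈ (univ.map f)ᶜ, ((σ (x : (A : Finset Λ)) : ℕ)) = 0 := by
        refine Finset.sum_eq_zero fun x hx => hσ.2 x fun y hy => ?_
        rw [Finset.mem_compl, Finset.mem_map] at hx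
        exact hx ⟨y, mem_univ _, hy⟩
      rw [h0, add_zero]
    rw [hsplit, ← Finset.sum_add_distrib, Finset.sum_congr rfl fun y _ => hσ.1 y, Finset.sum_const,
      Finset.card_univ, Fintype.card_coe, smul_eq_mul]
  refine ⟨v, ?_, ?_, ?_, ?_⟩
  · -- nonzero: the configuration `0` on `A`, `n` on `Aᶜ` is supported
    set σ₀ : TensorIndex Λ (n + 1) := fun z => if z ∈ A then 0 else Fin.last n with hσ₀
    have hS : Supp σ₀ := by
      refine ⟨fun y => ?_, fun x _ => ?_⟩
      · simp only [hσ₀, if_pos (hfA y), if_neg (hyA y), Fin.val_zero, Fin.val_last, zero_add]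
      · simp only [hσ₀, if_pos x.2, Fin.val_zero]
    have hm : marshallSign A σ₀ = 1 := by
      rw [marshallSign, Finset.sum_eq_zero fun z hz => by simp only [hσ₀, if_pos hz, Fin.val_zero],
        pow_zero]
    intro h0
    have := congrFun h0 σ₀
    rw [hv_apply, if_pos hS, hm, Pi.zero_apply] at this
    exact one_ne_zero this
  · -- in the sector of weight `|Aᶜ| n`
    rw [mem_spinZSector_weight_iff]
    intro σ hσ
    rw [hv_apply, if_neg]
    exact fun h => hσ (hweight σ h)
  · -- annihilated by `Ŝ⁺_tot`: the two sites of each singlet cancel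
    funext τ
    rw [raise_mulVec_apply, Pi.zero_apply]
    simp only [sum_spinRaise_apply_mul]
    -- the summand as a function of the site
    set F : Λ → ℂ := fun x => if h : (τ x).val + 1 < n + 1 then
        (Real.sqrt (((τ x).val + 1 : ℝ) * (n - (τ x).val : ℝ)) : ℂ) *
          v (Function.update τ x ⟨(τ x).val + 1, h⟩) else 0 with hF
    change ∑ x, F x = 0
    -- unpaired sites of `A` contribute nothing
    have hunp : ∀ x : (A : Finset Λ), (∀ y, f y ≠ x) → F x = 0 := by
      intro x hx
      simp only [hF]
      split_ifs with h
      · rw [hv_apply, if_neg, mul_zero]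
        intro hS
        have := hS.2 x hx
        rw [Function.update_self] at this
        simp at this
      · rfl
    -- regroup the sum over the pairs
    have hsum : ∑ x, F x = ∑ y : (Aᶜ : Finset Λ), (F (f y : (A : Finset Λ)) + F y) := by
      rw [← Finset.sum_add_sum_compl A, ← Finset.sum_coe_sort A, ← Finset.sum_coe_sort Aᶜ,
        ← Finset.sum_add_sum_compl (univ.map f), Finset.sum_map, Finset.sum_add_distrib]
      have h0 : ∑ x ∈ (univ.map f)ᶜ, F ((x : (A : Finset Λ)) : Λ) = 0 := by
        refine Finset.sum_eq_zero fun x hx => hunp x fun y hy => ?_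
        rw [Finset.mem_compl, Finset.mem_map] at hx
        exact hx ⟨y, mem_univ _, hy⟩
      rw [h0, add_zero]
    rw [hsum]
    refine Finset.sum_eq_zero fun y _ => ?_
    -- the pair `x = f y ∈ A`, `y ∈ Aᶜ`
    set x : Λ := ((f y : (A : Finset Λ)) : Λ) with hxdef
    have hxy : x ≠ (y : Λ) := hfy y y
    -- the common support condition of the two raised configurations
    have key : ∀ (z : Λ) (l : Fin (n + 1)), (z = x ∨ z = (y : Λ)) → (l : ℕ) = (τ z : ℕ) + 1 →
        (Supp (Function.update τ z l) ↔
          ((τ x : ℕ) + (τ y : ℕ) + 1 = n ∧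
            (∀ y' : (Aᶜ : Finset Λ), y' ≠ y → ((τ (f y' : (A : Finset Λ)) : ℕ)) + (τ y' : ℕ) = n) ∧
            ∀ x' : (A : Finset Λ), (∀ y', f y' ≠ x') → (τ x' : ℕ) = 0)) := by
      intro z l hz hl
      have hzx' : ∀ x' : (A : Finset Λ), (∀ y', f y' ≠ x') → (x' : Λ) ≠ z := by
        intro x' hx' h
        rcases hz with rfl | rfl
        · exact hx' y (Subtype.ext (by rw [← hxdef]; exact h.symm))
        · exact hyA y (h ▸ x'.2)
      have hzy' : ∀ y' : (Aᶜ : Finset Λ), y' ≠ y →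
          ((f y' : (A : Finset Λ)) : Λ) ≠ z ∧ (y' : Λ) ≠ z := by
        intro y' hy'
        rcases hz with rfl | rfl
        · refine ⟨fun h => hy' (f.injective (Subtype.ext h)), fun h => hyA y' ?_⟩
          rw [h]
          exact hfA y
        · exact ⟨hfy y' y, fun h => hy' (Subtype.ext h)⟩
      have hpair : ((Function.update τ z l x : Fin (n + 1)) : ℕ) + (Function.update τ z l y : ℕ) =
          (τ x : ℕ) + (τ y : ℕ) + 1 := by
        rcases hz with rfl | rfl
        · rw [Function.update_self, Function.update_of_ne hxy.symm, hl]
          ring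
        · rw [Function.update_self, Function.update_of_ne hxy, hl]
          ring
      simp only [hSupp]
      constructor
      · rintro ⟨h1, h2⟩
        refine ⟨?_, fun y' hy' => ?_, fun x' hx' => ?_⟩
        · have := h1 y
          rw [← hxdef, hpair] at this
          exact this
        · have := h1 y'
          rwa [Function.update_of_ne (hzy' y' hy').1, Function.update_of_ne (hzy' y' hy').2] at this
        · have := h2 x' hx'
          rwa [Function.update_of_ne (hzx' x' hx')] at this
      · rintro ⟨h1, h2, h3⟩
        refine ⟨fun y' => ?_, fun x' hx' => ?_⟩
        · by_cases hy' : y' = y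
          · subst hy'
            rw [← hxdef, hpair, h1]
          · rw [Function.update_of_ne (hzy' y' hy').1, Function.update_of_ne (hzy' y' hy').2]
            exact h2 y' hy'
        · rw [Function.update_of_ne (hzx' x' hx')]
          exact h3 x' hx'
    by_cases hR : (τ x : ℕ) + (τ y : ℕ) + 1 = n ∧
        (∀ y' : (Aᶜ : Finset Λ), y' ≠ y → ((τ (f y' : (A : Finset Λ)) : ℕ)) + (τ y' : ℕ) = n) ∧
        ∀ x' : (A : Finset Λ), (∀ y', f y' ≠ x') → (τ x' : ℕ) = 0
    · -- both raised configurations are supported: the singlet cancels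
      have hxn : (τ x).val + 1 < n + 1 := by omega
      have hyn : (τ (y : Λ)).val + 1 < n + 1 := by omega
      have hFx : F x = (Real.sqrt (((τ x).val + 1 : ℝ) * (n - (τ x).val : ℝ)) : ℂ) *
          -marshallSign A τ := by
        simp only [hF, dif_pos hxn]
        rw [hv_apply, if_pos ((key x _ (Or.inl rfl) rfl).2 hR), marshallSign_update_succ n A τ x _ rfl,
          if_pos (hfA y)]
      have hFy : F y = (Real.sqrt (((τ (y : Λ)).val + 1 : ℝ) * (n - (τ (y : Λ)).val : ℝ)) : ℂ) *
          marshallSign A τ := by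
        simp only [hF, dif_pos hyn]
        rw [hv_apply, if_pos ((key y _ (Or.inr rfl) rfl).2 hR), marshallSign_update_succ n A τ y _ rfl,
          if_neg (hyA y)]
      have hroot : Real.sqrt (((τ (y : Λ)).val + 1 : ℝ) * (n - (τ (y : Λ)).val : ℝ)) =
          Real.sqrt (((τ x).val + 1 : ℝ) * (n - (τ x).val : ℝ)) := by
        congr 1
        have h1 : ((τ (y : Λ)).val : ℝ) = (n : ℝ) - (τ x).val - 1 := by
          have : (τ (y : Λ)).val = n - (τ x).val - 1 := by omega
          rw [this, Nat.cast_sub (by omega), Nat.cast_sub (by omega)]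
          simp
        rw [h1]
        ring
      rw [hFx, hFy, hroot]
      ring
    · -- neither raised configuration is supported
      have hFx : F x = 0 := by
        simp only [hF]
        split_ifs with h
        · rw [hv_apply, if_neg (fun hS => hR ((key x _ (Or.inl rfl) rfl).1 hS)), mul_zero]
        · rfl
      have hFy : F y = 0 := by
        simp only [hF]
        split_ifs with h
        · rw [hv_apply, if_neg (fun hS => hR ((key y _ (Or.inr rfl) rfl).1 hS)), mul_zero]
        · rfl
      rw [hFx, hFy, add_zero]
  · -- coefficients are `0` or the Marshall sign
    intro σ
    rw [hv_apply]
    split_ifs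
    · exact Or.inr (marshallSign_mul_self A σ)
    · exact Or.inl (mul_zero _)

/-- **A Marshall-positive vector in the sector of the reference vector has
`(𝐒_tot)² = S₀(S₀+1)`**, `S₀ = |Λ| n/2 - |Aᶜ| n = (|A| - |Aᶜ|) n/2` being its magnetisation: it
is not orthogonal to the valence-bond reference vector (all overlaps have the same sign), which is a
highest-weight vector of that sector. Lieb–Mattis (1962), Thm 2 and its proof; Tasaki (2020)
§2.4, proof of Thm 2.3; Mattis (2006) §5.10. [folklore] -/
theorem totalSpinSq_eigenvalue_of_marshallPositive (A : Finset Λ) (hcard : Aᶜ.card ≤ A.card)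
    {ψ : TensorIndex Λ (n + 1) → ℂ}
    (hψ : ψ ∈ spinZSector (Λ := Λ) n (((Fintype.card Λ * n : ℕ) : ℝ) / 2 - (Aᶜ.card * n : ℕ)))
    (hpos : ∃ c : ℂ, c ≠ 0 ∧ ∀ σ : TensorIndex Λ (n + 1), (∑ z, (σ z : ℕ)) = Aᶜ.card * n →
      0 < (c * marshallSign A σ * ψ σ).re ∧ (c * marshallSign A σ * ψ σ).im = 0)
    {lam : ℂ} (hS : totalSpinSq n *ᵥ ψ = lam • ψ) :
    lam = (((((Fintype.card Λ * n : ℕ) : ℝ) / 2 - (Aᶜ.card * n : ℕ)) *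
      (((Fintype.card Λ * n : ℕ) : ℝ) / 2 - (Aᶜ.card * n : ℕ)) +
      (((Fintype.card Λ * n : ℕ) : ℝ) / 2 - (Aᶜ.card * n : ℕ)) : ℝ) : ℂ) := by
  obtain ⟨v, hv0, hvmem, hvraise, hvsign⟩ := exists_reference_vector n A hcard
  obtain ⟨c, hc0, hc⟩ := hpos
  set M : ℝ := ((Fintype.card Λ * n : ℕ) : ℝ) / 2 - (Aᶜ.card * n : ℕ) with hM
  have hSv := totalSpinSq_mulVec_of_raise_eq_zero n hvmem hvraise
  -- `⟨v, S² ψ⟩` computed in two ways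
  have h1 : star v ⬝ᵥ (totalSpinSq n *ᵥ ψ) = lam * (star v ⬝ᵥ ψ) := by
    rw [hS, dotProduct_smul, smul_eq_mul]
  have h2 : star v ⬝ᵥ (totalSpinSq n *ᵥ ψ) = ((M * M + M : ℝ) : ℂ) * (star v ⬝ᵥ ψ) := by
    rw [dotProduct_mulVec, show star v ᵥ* totalSpinSq n = star (totalSpinSq n *ᵥ v) by
      rw [star_mulVec, (totalSpinSq_isHermitian (Λ := Λ) n).eq], hSv, star_smul, smul_dotProduct,
      Complex.star_def, Complex.conj_ofReal, smul_eq_mul]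
  -- the overlap is nonzero: all terms of `c ⟨v, ψ⟩` are nonnegative reals, one is positive
  have hvψ : star v ⬝ᵥ ψ ≠ 0 := by
    have hvreal : ∀ σ, star (v σ) = v σ := by
      intro σ
      rcases hvsign σ with h | h
      · rcases mul_eq_zero.1 h with h' | h'
        · rcases marshallSign_eq_or A σ with h'' | h'' <;> rw [h''] at h' <;> norm_num at h'
        · rw [h', star_zero]
      · have : v σ = marshallSign A σ := by
          have hm := marshallSign_mul_self A σ
          linear_combination marshallSign A σ * h - v σ * hm
        rw [this, star_marshallSign]
    have hterm : ∀ σ, 0 ≤ (c * (star (v σ) * ψ σ)).re := by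
      intro σ
      rw [hvreal]
      rcases hvsign σ with h | h
      · rcases mul_eq_zero.1 h with h' | h'
        · rcases marshallSign_eq_or A σ with h'' | h'' <;> rw [h''] at h' <;> norm_num at h'
        · rw [h', zero_mul, mul_zero, Complex.zero_re]
      · by_cases hσ : (∑ z, (σ z : ℕ)) = Aᶜ.card * n
        · have hm := marshallSign_mul_self A σ
          have : c * (v σ * ψ σ) = c * marshallSign A σ * ψ σ := by
            linear_combination (c * ψ σ * marshallSign A σ) * h - (c * ψ σ * v σ) * hm
          rw [this]
          exact (hc σ hσ).1.le
        · rw [(mem_spinZSector_weight_iff n _ ψ).1 hψ σ hσ, mul_zero, mul_zero, Complex.zero_re]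
    obtain ⟨σ₁, hσ₁⟩ := Function.ne_iff.1 hv0
    have hσ₁w : (∑ z, (σ₁ z : ℕ)) = Aᶜ.card * n := by
      by_contra h
      exact hσ₁ ((mem_spinZSector_weight_iff n _ v).1 hvmem σ₁ h)
    have hpos₁ : 0 < (c * (star (v σ₁) * ψ σ₁)).re := by
      rw [hvreal]
      rcases hvsign σ₁ with h | h
      · rcases mul_eq_zero.1 h with h' | h'
        · rcases marshallSign_eq_or A σ₁ with h'' | h'' <;> rw [h''] at h' <;> norm_num at h'
        · exact absurd h' hσ₁
      · have hm := marshallSign_mul_self A σ₁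
        have : c * (v σ₁ * ψ σ₁) = c * marshallSign A σ₁ * ψ σ₁ := by
          linear_combination (c * ψ σ₁ * marshallSign A σ₁) * h - (c * ψ σ₁ * v σ₁) * hm
        rw [this]
        exact (hc σ₁ hσ₁w).1
    intro h0
    have hsum : (c * (star v ⬝ᵥ ψ)).re = ∑ σ, (c * (star (v σ) * ψ σ)).re := by
      rw [dotProduct, Finset.mul_sum, Complex.re_sum]
      rfl
    rw [h0, mul_zero, Complex.zero_re] at hsum
    have := Finset.single_le_sum (fun σ _ => hterm σ) (mem_univ σ₁)
    rw [← hsum] at this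
    exact absurd this (not_le.2 hpos₁)
  rw [h1] at h2
  exact mul_right_cancel₀ hvψ h2

/-! ### Test configurations: Marshall-positive vectors of weight `> |Aᶜ| n` are not highest weight -/

/-- **A Marshall-positive vector of weight `W > |Aᶜ| n` is not annihilated by `Ŝ⁺_tot`.**
Evaluate `(Ŝ⁺_tot ψ)(τ)` at a configuration `τ` of weight `W - 1` which is fully down (`k = n`) on
`Aᶜ`: only sites of `A` with `τ_x < n` contribute, each with amplitude
`√((τ_x+1)(n-τ_x)) ψ(τ + δ_x)`, and all these `ψ`-values have the sign `-(-1)^{Σ_A τ}`; at least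
one site of `A` has room. Lieb–Mattis (1962), proof of Thm 2; Tasaki (2020) §2.4, proof of
Thm 2.3. [folklore] -/
theorem raise_mulVec_ne_zero_of_marshallPositive (A : Finset Λ) {W : ℕ} (hW1 : Aᶜ.card * n < W)
    (hW2 : W ≤ Fintype.card Λ * n) {ψ : TensorIndex Λ (n + 1) → ℂ}
    (hpos : ∃ c : ℂ, c ≠ 0 ∧ ∀ σ : TensorIndex Λ (n + 1), (∑ z, (σ z : ℕ)) = W →
      0 < (c * marshallSign A σ * ψ σ).re ∧ (c * marshallSign A σ * ψ σ).im = 0) :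
    (totalSpin n 0 + I • totalSpin n 1 : Op Λ (n + 1)) *ᵥ ψ ≠ 0 := by
  classical
  obtain ⟨c, hc0, hc⟩ := hpos
  have hcardΛ : A.card + Aᶜ.card = Fintype.card Λ := Finset.card_add_card_compl A
  have hT : W - 1 - Aᶜ.card * n ≤ Aᶜᶜ.card * n := by
    rw [compl_compl]
    have : W ≤ (A.card + Aᶜ.card) * n := by rw [hcardΛ]; exact hW2
    have : W ≤ A.card * n + Aᶜ.card * n := by linarith [add_mul A.card Aᶜ.card n]
    omega
  obtain ⟨τ, hτfrozen, hτsum⟩ := exists_config n Aᶜ (Fin.last n) _ hT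
  rw [compl_compl] at hτsum
  have hτw : (∑ z, (τ z : ℕ)) + 1 = W := by
    rw [weight_eq_sum_add_sum_compl n A τ, hτsum]
    have : ∑ z ∈ Aᶜ, (τ z : ℕ) = Aᶜ.card * n := by
      rw [Finset.card_eq_sum_ones, Finset.sum_mul]
      exact Finset.sum_congr rfl fun z hz => by rw [hτfrozen z hz, Fin.val_last, one_mul]
    rw [this]
    omega
  intro h0
  have h1 := congrFun h0 τ
  rw [raise_mulVec_apply, Pi.zero_apply] at h1
  simp only [sum_spinRaise_apply_mul] at h1
  -- multiply by `c (-1)^{Σ_A τ}`: every term becomes a nonpositive real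
  set F : Λ → ℂ := fun x => if h : (τ x).val + 1 < n + 1 then
      (Real.sqrt (((τ x).val + 1 : ℝ) * (n - (τ x).val : ℝ)) : ℂ) *
        ψ (Function.update τ x ⟨(τ x).val + 1, h⟩) else 0 with hF
  change ∑ x, F x = 0 at h1
  have hterm : ∀ x, (c * marshallSign A τ * F x).re ≤ 0 ∧
      (x ∈ A → (τ x).val < n → (c * marshallSign A τ * F x).re < 0) := by
    intro x
    by_cases hx : (τ x).val + 1 < n + 1
    · have hxA : x ∈ A := by
        by_contra hxA
        have := hτfrozen x (Finset.mem_compl.2 hxA)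
        rw [this, Fin.val_last] at hx
        omega
      have hw : (∑ z, ((Function.update τ x ⟨(τ x).val + 1, hx⟩ z : Fin (n + 1)) : ℕ)) = W := by
        rw [weight_update_succ n τ x _ rfl, hτw]
      obtain ⟨hp, hpi⟩ := hc _ hw
      rw [marshallSign_update_succ n A τ x _ rfl, if_pos hxA] at hp hpi
      obtain ⟨r, hr0, hr⟩ := spinRaise_apply_pos n (k := τ x) (l := ⟨(τ x).val + 1, hx⟩) rfl
      rw [spinRaise_apply, if_pos rfl] at hr
      have hval : c * marshallSign A τ * F x =
          -(r : ℂ) * (c * -marshallSign A τ * ψ (Function.update τ x ⟨(τ x).val + 1, hx⟩)) := by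
        simp only [hF, dif_pos hx]
        rw [hr]
        ring
      have hre : (c * marshallSign A τ * F x).re =
          -r * (c * -marshallSign A τ * ψ (Function.update τ x ⟨(τ x).val + 1, hx⟩)).re := by
        rw [hval, show (-(r : ℂ)) = ((-r : ℝ) : ℂ) by push_cast; ring, Complex.re_ofReal_mul]
      refine ⟨?_, fun _ _ => ?_⟩
      · rw [hre]
        nlinarith
      · rw [hre]
        nlinarith
    · have hF0 : F x = 0 := by simp only [hF, dif_neg hx]
      refine ⟨by rw [hF0, mul_zero, Complex.zero_re], fun _ hxn => ?_⟩
      omega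
  -- some site of `A` has room
  obtain ⟨x₀, hx₀A, hx₀⟩ : ∃ x ∈ A, (τ x).val < n := by
    by_contra h
    push Not at h
    have : ∑ z ∈ A, (τ z : ℕ) = A.card * n := by
      rw [Finset.card_eq_sum_ones, Finset.sum_mul]
      refine Finset.sum_congr rfl fun z hz => ?_
      have := (τ z).isLt
      have := h z hz
      omega
    have hW2' : W ≤ (A.card + Aᶜ.card) * n := by rw [hcardΛ]; exact hW2
    have : W ≤ A.card * n + Aᶜ.card * n := by linarith [add_mul A.card Aᶜ.card n]
    omega
  have hsum : (∑ x, (c * marshallSign A τ * F x).re) = 0 := by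
    rw [← Complex.re_sum, ← Finset.mul_sum, h1, mul_zero, Complex.zero_re]
  have hall := (Finset.sum_eq_zero_iff_of_nonpos fun x _ => (hterm x).1).1 hsum x₀ (mem_univ x₀)
  exact absurd hall ((hterm x₀).2 hx₀A hx₀).ne

end QLattice

/-! ## Part 2: ordering of the sector energies -/


section QLattice

variable {Λ : Type*} [Fintype Λ] [DecidableEq Λ] (n : ℕ) (G : SimpleGraph Λ) [DecidableRel G.Adj]
  (J : ℝ)

/-! ### Nonempty sectors -/

omit [DecidableEq Λ] in
/-- A nonzero vector of a weight sector witnesses a configuration of that weight. [folklore] -/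
theorem exists_weight_of_mem_ne_zero [DecidableEq Λ] (W : ℕ) {ψ : TensorIndex Λ (n + 1) → ℂ}
    (hψ : ψ ∈ spinZSector (Λ := Λ) n (((Fintype.card Λ * n : ℕ) : ℝ) / 2 - W)) (hψ0 : ψ ≠ 0) :
    ∃ σ : TensorIndex Λ (n + 1), (∑ z, (σ z : ℕ)) = W := by
  by_contra h
  push Not at h
  exact hψ0 (funext fun σ => (mem_spinZSector_weight_iff n W ψ).1 hψ σ (h σ))

/-- Every weight `W ≤ |Λ| n` occurs. [folklore] -/
theorem exists_weight_eq (W : ℕ) (hW : W ≤ Fintype.card Λ * n) :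
    ∃ σ : TensorIndex Λ (n + 1), (∑ z, (σ z : ℕ)) = W := by
  obtain ⟨τ, -, hτ⟩ := exists_config n (∅ : Finset Λ) 0 W (by rwa [Finset.compl_empty, Finset.card_univ])
  exact ⟨τ, by rwa [Finset.compl_empty] at hτ⟩

/-! ### Transfer of ground states between neighbouring sectors -/

/-- **Lowering transfer.** If a vector `φ` of the sector of weight `W` with `Ŝ⁻φ ≠ 0` is an
eigenvector of `H` at the ground energy and of `(𝐒_tot)²` with eigenvalue `μ`, then the sector of
weight `W + 1` has sector energy equal to the ground energy and all its ground states have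
`(𝐒_tot)²`-eigenvalue `μ` (`Ŝ⁻` commutes with `H` and `(𝐒_tot)²`; Perron–Frobenius uniqueness in
the sector). Lieb–Mattis (1962), proof of Thm 2; Tasaki (2020) §2.4, proof of Thm 2.3. [folklore] -/
theorem transfer_lower (A : Finset Λ) (hG : G.Connected) (hA : G.IsBipartiteWith (A : Set Λ) (↑A)ᶜ)
    (hJ : 0 < J) (W : ℕ) {φ : TensorIndex Λ (n + 1) → ℂ}
    (hφ : φ ∈ spinZSector (Λ := Λ) n (((Fintype.card Λ * n : ℕ) : ℝ) / 2 - W))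
    (hφ0 : (totalSpin n 0 - I • totalSpin n 1 : Op Λ (n + 1)) *ᵥ φ ≠ 0)
    (hHφ : heisenbergHamiltonian n G J *ᵥ φ =
      (((heisenbergHamiltonian n G J).groundEnergy : ℝ) : ℂ) • φ)
    {μ : ℂ} (hSφ : totalSpinSq n *ᵥ φ = μ • φ) :
    lowestEnergyInSector n (heisenbergHamiltonian n G J)
        (((Fintype.card Λ * n : ℕ) : ℝ) / 2 - (W + 1 : ℕ)) = (heisenbergHamiltonian n G J).groundEnergy ∧
      ∀ ψ ∈ spinZSector (Λ := Λ) n (((Fintype.card Λ * n : ℕ) : ℝ) / 2 - (W + 1 : ℕ)),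
        heisenbergHamiltonian n G J *ᵥ ψ =
          ((lowestEnergyInSector n (heisenbergHamiltonian n G J)
            (((Fintype.card Λ * n : ℕ) : ℝ) / 2 - (W + 1 : ℕ)) : ℝ) : ℂ) • ψ →
        totalSpinSq n *ᵥ ψ = μ • ψ := by
  have hmem := lower_mulVec_mem n hφ
  have heig := mulVec_eigenvector_of_commute n (commute_heisenbergHamiltonian_lower n G J) hHφ
  have hE := lowestEnergyInSector_eq_groundEnergy_of_eigenvector n G J (W + 1) hmem hφ0 heig
  refine ⟨hE, fun ψ hψ hHψ => ?_⟩
  by_cases hψ0 : ψ = 0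
  · rw [hψ0, mulVec_zero, smul_zero]
  obtain ⟨-, -, huniq, -⟩ := sector_perronFrobenius n G J A hG hA hJ (W + 1)
    (exists_weight_of_mem_ne_zero n (W + 1) hψ hψ0)
  rw [← hE] at heig
  obtain ⟨c, hc⟩ := huniq _ ψ hmem hψ heig hHψ hφ0
  have hS := mulVec_eigenvector_of_commute n (commute_totalSpinSq_lower n) hSφ
  rw [hc, mulVec_smul, hS, smul_comm]

/-- **Raising transfer.** If a vector `φ` of the sector of weight `W + 1` with `Ŝ⁺φ ≠ 0` is an
eigenvector of `H` at the ground energy and of `(𝐒_tot)²` with eigenvalue `μ`, then the sector of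
weight `W` has sector energy equal to the ground energy and all its ground states have
`(𝐒_tot)²`-eigenvalue `μ`. Lieb–Mattis (1962), proof of Thm 2; Tasaki (2020) §2.4, proof of
Thm 2.3. [folklore] -/
theorem transfer_raise (A : Finset Λ) (hG : G.Connected) (hA : G.IsBipartiteWith (A : Set Λ) (↑A)ᶜ)
    (hJ : 0 < J) (W : ℕ) {φ : TensorIndex Λ (n + 1) → ℂ}
    (hφ : φ ∈ spinZSector (Λ := Λ) n (((Fintype.card Λ * n : ℕ) : ℝ) / 2 - (W + 1 : ℕ)))
    (hφ0 : (totalSpin n 0 + I • totalSpin n 1 : Op Λ (n + 1)) *ᵥ φ ≠ 0)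
    (hHφ : heisenbergHamiltonian n G J *ᵥ φ =
      (((heisenbergHamiltonian n G J).groundEnergy : ℝ) : ℂ) • φ)
    {μ : ℂ} (hSφ : totalSpinSq n *ᵥ φ = μ • φ) :
    lowestEnergyInSector n (heisenbergHamiltonian n G J)
        (((Fintype.card Λ * n : ℕ) : ℝ) / 2 - W) = (heisenbergHamiltonian n G J).groundEnergy ∧
      ∀ ψ ∈ spinZSector (Λ := Λ) n (((Fintype.card Λ * n : ℕ) : ℝ) / 2 - W),
        heisenbergHamiltonian n G J *ᵥ ψ =
          ((lowestEnergyInSector n (heisenbergHamiltonian n G J)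
            (((Fintype.card Λ * n : ℕ) : ℝ) / 2 - W) : ℝ) : ℂ) • ψ →
        totalSpinSq n *ᵥ ψ = μ • ψ := by
  have hmem := raise_mulVec_mem n hφ
  have heig := mulVec_eigenvector_of_commute n (commute_heisenbergHamiltonian_raise n G J) hHφ
  have hE := lowestEnergyInSector_eq_groundEnergy_of_eigenvector n G J W hmem hφ0 heig
  refine ⟨hE, fun ψ hψ hHψ => ?_⟩
  by_cases hψ0 : ψ = 0
  · rw [hψ0, mulVec_zero, smul_zero]
  obtain ⟨-, -, huniq, -⟩ := sector_perronFrobenius n G J A hG hA hJ W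
    (exists_weight_of_mem_ne_zero n W hψ hψ0)
  rw [← hE] at heig
  obtain ⟨c, hc⟩ := huniq _ ψ hmem hψ heig hHψ hφ0
  have hS := mulVec_eigenvector_of_commute n (commute_totalSpinSq_raise n) hSφ
  rw [hc, mulVec_smul, hS, smul_comm]

/-! ### Monotonicity of the sector energies -/

/-- **`E(W) ≤ E(W+1)` for `W ≥ |Aᶜ| n`**, i.e. `E(M) ≤ E(M-1)` for every magnetisation
`M ≤ S₀ = (|A| - |Aᶜ|) n/2`: the Marshall-positive ground state of the sector of weight `W + 1`
is not a highest-weight vector (`raise_mulVec_ne_zero_of_marshallPositive`), so `Ŝ⁺_tot` maps it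
to a nonzero eigenvector of `H` with the same energy in the sector of weight `W`.
Lieb–Mattis (1962), proof of Thm 2; Tasaki (2020) §2.4, proof of Thm 2.3. [folklore] -/
theorem lowestEnergyInSector_le_succ (A : Finset Λ) (hG : G.Connected)
    (hA : G.IsBipartiteWith (A : Set Λ) (↑A)ᶜ) (hJ : 0 < J) (W : ℕ) (hW1 : Aᶜ.card * n ≤ W)
    (hW2 : W + 1 ≤ Fintype.card Λ * n) :
    lowestEnergyInSector n (heisenbergHamiltonian n G J) (((Fintype.card Λ * n : ℕ) : ℝ) / 2 - W) ≤
      lowestEnergyInSector n (heisenbergHamiltonian n G J)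
        (((Fintype.card Λ * n : ℕ) : ℝ) / 2 - (W + 1 : ℕ)) := by
  obtain ⟨⟨ψ, hψ, hψ0, hHψ⟩, -, -, hpos⟩ := sector_perronFrobenius n G J A hG hA hJ (W + 1)
    (exists_weight_eq n (W + 1) hW2)
  have hne := raise_mulVec_ne_zero_of_marshallPositive n A (W := W + 1) (by omega) hW2
    (hpos ψ hψ hHψ hψ0)
  exact lowestEnergyInSector_le_of_eigenvector n G J W (raise_mulVec_mem n hψ) hne
    (mulVec_eigenvector_of_commute n (commute_heisenbergHamiltonian_raise n G J) hHψ)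

/-- **`E(W+1) ≤ E(W)` for `2W < |Λ| n`** (i.e. `E(M - 1) ≤ E(M)` for `M > 0`: every multiplet of
magnetisation `M > 0` has a member at `M - 1`; `SU(2)` invariance). Tasaki (2020) §2.4, before
Thm 2.3 ("trivially `E(M) ≤ E(M')` for `|M| ≤ |M'|`"). [folklore] -/
theorem lowestEnergyInSector_succ_le (W : ℕ) (hW : 2 * W < Fintype.card Λ * n) :
    lowestEnergyInSector n (heisenbergHamiltonian n G J)
        (((Fintype.card Λ * n : ℕ) : ℝ) / 2 - (W + 1 : ℕ)) ≤
      lowestEnergyInSector n (heisenbergHamiltonian n G J) (((Fintype.card Λ * n : ℕ) : ℝ) / 2 - W) := by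
  obtain ⟨⟨ψ, hψ, hψ0, hHψ⟩, -⟩ := sector_groundState_weight n G J W (exists_weight_eq n W (by omega))
  have hM : (0 : ℝ) < ((Fintype.card Λ * n : ℕ) : ℝ) / 2 - W := by
    have : (2 * W : ℝ) < ((Fintype.card Λ * n : ℕ) : ℝ) := by exact_mod_cast hW
    linarith
  have hne := lower_mulVec_ne_zero_of_pos n hM hψ hψ0
  exact lowestEnergyInSector_le_of_eigenvector n G J (W + 1) (lower_mulVec_mem n hψ) hne
    (mulVec_eigenvector_of_commute n (commute_heisenbergHamiltonian_lower n G J) hHψ)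

/-- **`E(|Aᶜ| n)` is the least sector energy** (`|Aᶜ| ≤ |A|`): `E(S₀) ≤ E(M)` for all `M`.
Lieb–Mattis (1962), Thm 2; Tasaki (2020) Thm 2.3, eq. (2.4.7). [folklore] -/
theorem lowestEnergyInSector_weight_le (A : Finset Λ) (hG : G.Connected)
    (hA : G.IsBipartiteWith (A : Set Λ) (↑A)ᶜ) (hJ : 0 < J) (hcard : Aᶜ.card ≤ A.card) (W : ℕ)
    (hW : W ≤ Fintype.card Λ * n) :
    lowestEnergyInSector n (heisenbergHamiltonian n G J)
        (((Fintype.card Λ * n : ℕ) : ℝ) / 2 - (Aᶜ.card * n : ℕ)) ≤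
      lowestEnergyInSector n (heisenbergHamiltonian n G J) (((Fintype.card Λ * n : ℕ) : ℝ) / 2 - W) := by
  have hcardΛ : A.card + Aᶜ.card = Fintype.card Λ := Finset.card_add_card_compl A
  by_cases hle : Aᶜ.card * n ≤ W
  · -- upwards from `N₀`
    obtain ⟨d, rfl⟩ := Nat.exists_eq_add_of_le hle
    induction d with
    | zero => exact le_rfl
    | succ d ih =>
      exact (ih (by omega) (by omega)).trans
        (lowestEnergyInSector_le_succ n G J A hG hA hJ (Aᶜ.card * n + d) (by omega) (by omega))
  · -- downwards from `N₀`
    push Not at hle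
    obtain ⟨d, hd⟩ := Nat.exists_eq_add_of_le hle.le
    have key : ∀ (d W : ℕ), Aᶜ.card * n = W + d →
        lowestEnergyInSector n (heisenbergHamiltonian n G J)
            (((Fintype.card Λ * n : ℕ) : ℝ) / 2 - (Aᶜ.card * n : ℕ)) ≤
          lowestEnergyInSector n (heisenbergHamiltonian n G J)
            (((Fintype.card Λ * n : ℕ) : ℝ) / 2 - W) := by
      intro d
      induction d with
      | zero =>
        intro W h
        rw [h, add_zero]
      | succ d ih =>
        intro W h
        have h2 : 2 * W < Fintype.card Λ * n := by
          have : Aᶜ.card * n ≤ A.card * n := Nat.mul_le_mul_right n hcard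
          rw [← hcardΛ]
          nlinarith
        exact (ih (W + 1) (by omega)).trans (lowestEnergyInSector_succ_le n G J W h2)
    exact key d W hd

/-- **The sector energy at weight `|Aᶜ| n` is the ground energy**: `E(S₀) = E₀`
(a global ground state has a nonzero component in some sector, whose energy is then `E₀`).
Lieb–Mattis (1962), Thm 2; Tasaki (2020) Thm 2.3. [folklore] -/
theorem lowestEnergyInSector_weight_eq_groundEnergy (A : Finset Λ) (hG : G.Connected)
    (hA : G.IsBipartiteWith (A : Set Λ) (↑A)ᶜ) (hJ : 0 < J) (hcard : Aᶜ.card ≤ A.card) :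
    lowestEnergyInSector n (heisenbergHamiltonian n G J)
        (((Fintype.card Λ * n : ℕ) : ℝ) / 2 - (Aᶜ.card * n : ℕ)) =
      (heisenbergHamiltonian n G J).groundEnergy := by
  have hcardΛ : A.card + Aᶜ.card = Fintype.card Λ := Finset.card_add_card_compl A
  refine le_antisymm ?_ (groundEnergy_le_lowestEnergyInSector n G J _ (exists_weight_eq n _ ?_))
  · -- a global ground state and a nonzero sector component of it
    have hH := heisenbergHamiltonian_isHermitian n G J
    haveI : Nonempty (TensorIndex Λ (n + 1)) := ⟨fun _ => 0⟩
    obtain ⟨Φ, hΦ, hΦ0⟩ := (Submodule.ne_bot_iff _).1 (Matrix.groundSpace_ne_bot_holds hH)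
    rw [Matrix.mem_groundSpace_iff] at hΦ
    obtain ⟨W, hWr, hW0⟩ : ∃ W ∈ Finset.range (Fintype.card Λ * n + 1),
        (fun σ : TensorIndex Λ (n + 1) => if (∑ z, (σ z : ℕ)) = W then Φ σ else 0) ≠ 0 := by
      by_contra h
      push Not at h
      apply hΦ0
      rw [← sum_components n Φ]
      exact Finset.sum_eq_zero h
    have hle := lowestEnergyInSector_le_of_eigenvector n G J W (component_mem n Φ W) hW0
      (heisenbergHamiltonian_mulVec_component n G J hΦ W)
    exact (lowestEnergyInSector_weight_le n G J A hG hA hJ hcard W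
      (Nat.lt_succ_iff.1 (Finset.mem_range.1 hWr))).trans hle
  · have : Aᶜ.card * n ≤ (A.card + Aᶜ.card) * n := Nat.mul_le_mul_right n (by omega)
    rwa [hcardΛ] at this

end QLattice

/-! ## Part 3: the sectors between the extremal magnetisations, and the discharge -/


section QLattice

variable {Λ : Type*} [Fintype Λ] [DecidableEq Λ] (n : ℕ) (G : SimpleGraph Λ) [DecidableRel G.Adj]
  (J : ℝ)

/-! ### The sectors `N₀ ≤ W ≤ N₁`: energy `E₀` and total spin `S₀` -/

/-- **Between the extremal magnetisations `±S₀` every sector reaches the ground energy with total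
spin `S₀`**: for `|Aᶜ| n ≤ W ≤ |A| n` the sector energy is `E₀` and every ground state of the
sector satisfies `(𝐒_tot)² ψ = S₀(S₀+1) ψ`, `S₀ = |Λ| n/2 - |Aᶜ| n`. Induction on `W` from the
reference sector `N₀ = |Aᶜ| n`: the sector ground state is never a lowest-weight vector
(`S₀(S₀+1) ≠ M(M-1)` for `-S₀ < M ≤ S₀`), and `Ŝ⁻` transfers energy and spin to the next sector.
Lieb–Mattis (1962), Thm 2 and its proof; Tasaki (2020) Thm 2.3. [folklore] -/
theorem sector_between (A : Finset Λ) (hG : G.Connected) (hA : G.IsBipartiteWith (A : Set Λ) (↑A)ᶜ)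
    (hJ : 0 < J) (hcard : Aᶜ.card ≤ A.card) (W : ℕ) (hW1 : Aᶜ.card * n ≤ W) (hW2 : W ≤ A.card * n) :
    lowestEnergyInSector n (heisenbergHamiltonian n G J) (((Fintype.card Λ * n : ℕ) : ℝ) / 2 - W) =
        (heisenbergHamiltonian n G J).groundEnergy ∧
      ∀ ψ ∈ spinZSector (Λ := Λ) n (((Fintype.card Λ * n : ℕ) : ℝ) / 2 - W),
        heisenbergHamiltonian n G J *ᵥ ψ =
          ((lowestEnergyInSector n (heisenbergHamiltonian n G J)
            (((Fintype.card Λ * n : ℕ) : ℝ) / 2 - W) : ℝ) : ℂ) • ψ →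
        totalSpinSq n *ᵥ ψ =
          ((((((Fintype.card Λ * n : ℕ) : ℝ) / 2 - (Aᶜ.card * n : ℕ)) *
              (((Fintype.card Λ * n : ℕ) : ℝ) / 2 - (Aᶜ.card * n : ℕ)) +
              (((Fintype.card Λ * n : ℕ) : ℝ) / 2 - (Aᶜ.card * n : ℕ)) : ℝ)) : ℂ) • ψ := by
  have hcardΛ : A.card + Aᶜ.card = Fintype.card Λ := Finset.card_add_card_compl A
  have hWmax : A.card * n + Aᶜ.card * n = Fintype.card Λ * n := by rw [← hcardΛ, add_mul]
  have hcast : (Fintype.card Λ : ℝ) * n = (A.card : ℝ) * n + (Aᶜ.card : ℝ) * n := by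
    rw [← hcardΛ]
    push_cast
    ring
  obtain ⟨k, rfl⟩ := Nat.exists_eq_add_of_le hW1
  induction k with
  | zero =>
    have hE := lowestEnergyInSector_weight_eq_groundEnergy n G J A hG hA hJ hcard
    simp only [Nat.add_zero] at hE ⊢
    refine ⟨hE, fun ψ hψ hHψ => ?_⟩
    by_cases hψ0 : ψ = 0
    · rw [hψ0, mulVec_zero, smul_zero]
    obtain ⟨-, -, -, hpos⟩ := sector_perronFrobenius n G J A hG hA hJ (Aᶜ.card * n)
      (exists_weight_of_mem_ne_zero n _ hψ hψ0)
    obtain ⟨lam, hlam⟩ := sector_groundState_totalSpinSq n G J A hG hA hJ (Aᶜ.card * n) hψ hHψ hψ0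
    rw [hlam, totalSpinSq_eigenvalue_of_marshallPositive n A hcard hψ (hpos ψ hψ hHψ hψ0) hlam]
  | succ k ih =>
    obtain ⟨hE, hS⟩ := ih (by omega) (by omega)
    -- the sector ground state at `N₀ + k`
    obtain ⟨⟨φ, hφ, hφ0, hHφ⟩, -, -, -⟩ := sector_perronFrobenius n G J A hG hA hJ (Aᶜ.card * n + k)
      (exists_weight_eq n _ (by rw [← hWmax]; omega))
    have hSφ := hS φ hφ hHφ
    rw [hE] at hHφ
    -- it is not a lowest-weight vector
    have hlow : (totalSpin n 0 - I • totalSpin n 1 : Op Λ (n + 1)) *ᵥ φ ≠ 0 := by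
      intro h0
      have h1 := totalSpinSq_mulVec_of_lower_eq_zero n hφ h0
      have h2 := eigenvalue_eq_of_eq_smul n hSφ h1 (one_smul ℂ φ).symm one_ne_zero hφ0
      have h3 := Complex.ofReal_injective h2
      push_cast at h3
      have hk : ((k : ℝ) + 1) ≤ (A.card : ℝ) * n - (Aᶜ.card : ℝ) * n := by
        have : Aᶜ.card * n + (k + 1) ≤ A.card * n := by omega
        have : ((Aᶜ.card * n + (k + 1) : ℕ) : ℝ) ≤ ((A.card * n : ℕ) : ℝ) := by exact_mod_cast this
        push_cast at this
        linarith
      rw [hcast] at h3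
      have h4 : ((A.card : ℝ) * n - (Aᶜ.card : ℝ) * n - k) * ((k : ℝ) + 1) = 0 := by
        linear_combination h3
      rcases mul_eq_zero.1 h4 with h5 | h5
      · linarith
      · have : (0 : ℝ) ≤ k := Nat.cast_nonneg k
        linarith
    have key := transfer_lower n G J A hG hA hJ (Aᶜ.card * n + k) hφ hlow hHφ hSφ
    rw [show Aᶜ.card * n + (k + 1) = Aᶜ.card * n + k + 1 by ring]
    exact key

/-- **No sector of magnetisation `M > S₀` reaches the ground energy**: for `W < |Aᶜ| n`,
`E(W) ≠ E₀`. Otherwise the `(𝐒_tot)²` eigenvalue `λ ≥ M(M+1) > S₀(S₀+1)` of the sector ground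
state would be transported by `Ŝ⁻` (every `M > 0` vector is lowered nontrivially) down to the
sector `S₀`, where the eigenvalue is `S₀(S₀+1)`. Lieb–Mattis (1962), Thm 2 (`E(S+1) > E(S)` for
`S ≥ 𝒮`); Tasaki (2020) Thm 2.3. [folklore] -/
theorem lowestEnergyInSector_ne_groundEnergy_of_lt (A : Finset Λ) (hG : G.Connected)
    (hA : G.IsBipartiteWith (A : Set Λ) (↑A)ᶜ) (hJ : 0 < J) (hcard : Aᶜ.card ≤ A.card) (W : ℕ)
    (hW : W < Aᶜ.card * n) :
    lowestEnergyInSector n (heisenbergHamiltonian n G J) (((Fintype.card Λ * n : ℕ) : ℝ) / 2 - W) ≠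
      (heisenbergHamiltonian n G J).groundEnergy := by
  intro heq
  have hcardΛ : A.card + Aᶜ.card = Fintype.card Λ := Finset.card_add_card_compl A
  have hWmax : A.card * n + Aᶜ.card * n = Fintype.card Λ * n := by rw [← hcardΛ, add_mul]
  have hcast : ((Fintype.card Λ * n : ℕ) : ℝ) = (A.card : ℝ) * n + (Aᶜ.card : ℝ) * n := by
    rw [← hcardΛ]
    push_cast
    ring
  have hbn : Aᶜ.card * n ≤ A.card * n := Nat.mul_le_mul_right n hcard
  -- the sector ground state at `W` and its `(𝐒_tot)²` eigenvalue
  obtain ⟨⟨ψ₀, hψ₀, hψ₀0, hHψ₀⟩, -, huniq, -⟩ := sector_perronFrobenius n G J A hG hA hJ W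
    (exists_weight_eq n _ (by rw [← hWmax]; omega))
  obtain ⟨lam, hlam⟩ := sector_groundState_totalSpinSq n G J A hG hA hJ W hψ₀ hHψ₀ hψ₀0
  have hlam_ge := (eigenvalue_totalSpinSq_ge_raise n hψ₀ hψ₀0 hlam).1
  -- transport `lam` up to the sector `N₀`
  have claim : ∀ k : ℕ, W + k ≤ Aᶜ.card * n →
      lowestEnergyInSector n (heisenbergHamiltonian n G J)
          (((Fintype.card Λ * n : ℕ) : ℝ) / 2 - (W + k : ℕ)) = (heisenbergHamiltonian n G J).groundEnergy ∧
        ∀ ψ ∈ spinZSector (Λ := Λ) n (((Fintype.card Λ * n : ℕ) : ℝ) / 2 - (W + k : ℕ)),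
          heisenbergHamiltonian n G J *ᵥ ψ =
            ((lowestEnergyInSector n (heisenbergHamiltonian n G J)
              (((Fintype.card Λ * n : ℕ) : ℝ) / 2 - (W + k : ℕ)) : ℝ) : ℂ) • ψ →
          totalSpinSq n *ᵥ ψ = lam • ψ := by
    intro k
    induction k with
    | zero =>
      intro _
      simp only [Nat.add_zero]
      refine ⟨heq, fun ψ hψ hHψ => ?_⟩
      obtain ⟨c, hc⟩ := huniq ψ₀ ψ hψ₀ hψ hHψ₀ hHψ hψ₀0
      rw [hc, mulVec_smul, hlam, smul_comm]
    | succ k ih =>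
      intro hk
      obtain ⟨hE, hS⟩ := ih (by omega)
      obtain ⟨⟨φ, hφ, hφ0, hHφ⟩, -, -, -⟩ := sector_perronFrobenius n G J A hG hA hJ (W + k)
        (exists_weight_eq n _ (by rw [← hWmax]; omega))
      have hSφ := hS φ hφ hHφ
      rw [hE] at hHφ
      have hM : (0 : ℝ) < ((Fintype.card Λ * n : ℕ) : ℝ) / 2 - (W + k : ℕ) := by
        rw [hcast]
        have : ((W + k : ℕ) : ℝ) + 1 ≤ ((Aᶜ.card * n : ℕ) : ℝ) := by exact_mod_cast hk
        have : ((Aᶜ.card * n : ℕ) : ℝ) ≤ ((A.card * n : ℕ) : ℝ) := by exact_mod_cast hbn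
        push_cast at *
        linarith
      have hlow := lower_mulVec_ne_zero_of_pos n hM hφ hφ0
      have key := transfer_lower n G J A hG hA hJ (W + k) hφ hlow hHφ hSφ
      rw [show W + (k + 1) = W + k + 1 by ring]
      exact key
  -- at `N₀` the eigenvalue is `S₀(S₀+1)`
  obtain ⟨d, hd⟩ := Nat.exists_eq_add_of_le hW.le
  obtain ⟨-, hS⟩ := claim d (by omega)
  rw [← hd] at hS
  obtain ⟨-, hS₀⟩ := sector_between n G J A hG hA hJ hcard (Aᶜ.card * n) le_rfl hbn
  obtain ⟨⟨φ, hφ, hφ0, hHφ⟩, -, -, -⟩ := sector_perronFrobenius n G J A hG hA hJ (Aᶜ.card * n)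
    (exists_weight_eq n _ (by rw [← hWmax]; omega))
  have h1 := hS φ hφ hHφ
  have h2 := hS₀ φ hφ hHφ
  have h3 := eigenvalue_eq_of_eq_smul n h1 h2 (one_smul ℂ φ).symm one_ne_zero hφ0
  -- but `lam ≥ M(M+1) > S₀(S₀+1)`
  have h4 := congrArg Complex.re h3
  rw [Complex.ofReal_re] at h4
  rw [h4, hcast] at hlam_ge
  have hd1 : (1 : ℝ) ≤ d := by
    have : 1 ≤ d := by omega
    exact_mod_cast this
  have hWd : (W : ℝ) + d = (Aᶜ.card : ℝ) * n := by
    have := congrArg (fun m : ℕ => (m : ℝ)) hd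
    push_cast at this
    linarith
  have hab : (Aᶜ.card : ℝ) * n ≤ (A.card : ℝ) * n := by exact_mod_cast hbn
  push_cast at hlam_ge
  nlinarith

/-- **No sector of magnetisation `M < -S₀` reaches the ground energy**: for `W > |A| n`,
`E(W) ≠ E₀` (mirror image of the previous statement, transporting the eigenvalue
`λ ≥ M(M-1) > S₀(S₀+1)` by `Ŝ⁺` up to the sector `-S₀`). Lieb–Mattis (1962), Thm 2; Tasaki (2020)
Thm 2.3. [folklore] -/
theorem lowestEnergyInSector_ne_groundEnergy_of_gt (A : Finset Λ) (hG : G.Connected)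
    (hA : G.IsBipartiteWith (A : Set Λ) (↑A)ᶜ) (hJ : 0 < J) (hcard : Aᶜ.card ≤ A.card) (W : ℕ)
    (hW1 : A.card * n < W) (hW2 : W ≤ Fintype.card Λ * n) :
    lowestEnergyInSector n (heisenbergHamiltonian n G J) (((Fintype.card Λ * n : ℕ) : ℝ) / 2 - W) ≠
      (heisenbergHamiltonian n G J).groundEnergy := by
  intro heq
  have hcardΛ : A.card + Aᶜ.card = Fintype.card Λ := Finset.card_add_card_compl A
  have hWmax : A.card * n + Aᶜ.card * n = Fintype.card Λ * n := by rw [← hcardΛ, add_mul]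
  have hcast : ((Fintype.card Λ * n : ℕ) : ℝ) = (A.card : ℝ) * n + (Aᶜ.card : ℝ) * n := by
    rw [← hcardΛ]
    push_cast
    ring
  have hbn : Aᶜ.card * n ≤ A.card * n := Nat.mul_le_mul_right n hcard
  obtain ⟨⟨ψ₀, hψ₀, hψ₀0, hHψ₀⟩, -, huniq, -⟩ := sector_perronFrobenius n G J A hG hA hJ W
    (exists_weight_eq n _ hW2)
  obtain ⟨lam, hlam⟩ := sector_groundState_totalSpinSq n G J A hG hA hJ W hψ₀ hHψ₀ hψ₀0
  have hlam_ge := eigenvalue_totalSpinSq_ge_lower n hψ₀ hψ₀0 hlam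
  -- transport `lam` down to the sector `N₁`
  have claim : ∀ k V : ℕ, V + k = W → A.card * n ≤ V →
      lowestEnergyInSector n (heisenbergHamiltonian n G J)
          (((Fintype.card Λ * n : ℕ) : ℝ) / 2 - V) = (heisenbergHamiltonian n G J).groundEnergy ∧
        ∀ ψ ∈ spinZSector (Λ := Λ) n (((Fintype.card Λ * n : ℕ) : ℝ) / 2 - V),
          heisenbergHamiltonian n G J *ᵥ ψ =
            ((lowestEnergyInSector n (heisenbergHamiltonian n G J)
              (((Fintype.card Λ * n : ℕ) : ℝ) / 2 - V) : ℝ) : ℂ) • ψ →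
          totalSpinSq n *ᵥ ψ = lam • ψ := by
    intro k
    induction k with
    | zero =>
      intro V hV _
      rw [Nat.add_zero] at hV
      subst hV
      refine ⟨heq, fun ψ hψ hHψ => ?_⟩
      obtain ⟨c, hc⟩ := huniq ψ₀ ψ hψ₀ hψ hHψ₀ hHψ hψ₀0
      rw [hc, mulVec_smul, hlam, smul_comm]
    | succ k ih =>
      intro V hV hV1
      obtain ⟨hE, hS⟩ := ih (V + 1) (by omega) (by omega)
      obtain ⟨⟨φ, hφ, hφ0, hHφ⟩, -, -, -⟩ := sector_perronFrobenius n G J A hG hA hJ (V + 1)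
        (exists_weight_eq n _ (by omega))
      have hSφ := hS φ hφ hHφ
      rw [hE] at hHφ
      have hM : ((Fintype.card Λ * n : ℕ) : ℝ) / 2 - (V + 1 : ℕ) < 0 := by
        rw [hcast]
        have : ((A.card * n : ℕ) : ℝ) ≤ ((V : ℕ) : ℝ) := by exact_mod_cast hV1
        have : ((Aᶜ.card * n : ℕ) : ℝ) ≤ ((A.card * n : ℕ) : ℝ) := by exact_mod_cast hbn
        push_cast at *
        linarith
      have hraise := raise_mulVec_ne_zero_of_neg n hM hφ hφ0
      exact transfer_raise n G J A hG hA hJ V hφ hraise hHφ hSφ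
  obtain ⟨-, hS⟩ := claim (W - A.card * n) (A.card * n) (by omega) le_rfl
  obtain ⟨-, hS₀⟩ := sector_between n G J A hG hA hJ hcard (A.card * n) hbn le_rfl
  obtain ⟨⟨φ, hφ, hφ0, hHφ⟩, -, -, -⟩ := sector_perronFrobenius n G J A hG hA hJ (A.card * n)
    (exists_weight_eq n _ (by rw [← hWmax]; omega))
  have h1 := hS φ hφ hHφ
  have h2 := hS₀ φ hφ hHφ
  have h3 := eigenvalue_eq_of_eq_smul n h1 h2 (one_smul ℂ φ).symm one_ne_zero hφ0
  have h4 := congrArg Complex.re h3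
  rw [Complex.ofReal_re] at h4
  rw [h4, hcast] at hlam_ge
  have hW1' : (A.card : ℝ) * n + 1 ≤ W := by
    have : A.card * n + 1 ≤ W := hW1
    exact_mod_cast this
  have hab : (Aᶜ.card : ℝ) * n ≤ (A.card : ℝ) * n := by exact_mod_cast hbn
  push_cast at hlam_ge
  nlinarith

/-! ### The main theorem for `|Aᶜ| ≤ |A|` -/

/-- **Lieb–Mattis theorem (spin and degeneracy of the ground states), case `|Aᶜ| ≤ |A|`.**
Every ground state of the bipartite Heisenberg antiferromagnet has `(𝐒_tot)² = S₀(S₀+1)`,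
`S₀ = liebMattisSpin n A = |(|A| - |Aᶜ|)| n/2`, and the ground space, being the direct sum of
the one-dimensional sector ground spaces for `|Aᶜ| n ≤ W ≤ |A| n`, has dimension `2S₀ + 1`.
Lieb–Mattis, J. Math. Phys. 3 (1962) 749, Thm 2; Tasaki (2020) Thm 2.3; Mattis (2006) §5.10.
[folklore] -/
theorem marshall_lieb_mattis_spin_of_card_le (A : Finset Λ) (hG : G.Connected)
    (hA : G.IsBipartiteWith (A : Set Λ) (↑A)ᶜ) (hJ : 0 < J) (hcard : Aᶜ.card ≤ A.card) :
    (∀ ψ : TensorIndex Λ (n + 1) → ℂ, (heisenbergHamiltonian n G J).IsGroundStateVector ψ →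
      totalSpinSq n *ᵥ ψ =
        ((liebMattisSpin n A * (liebMattisSpin n A + 1) : ℝ) : ℂ) • ψ) ∧
    ((heisenbergHamiltonian n G J).groundStateDegeneracy : ℝ) = 2 * liebMattisSpin n A + 1 := by
  have hcardΛ : A.card + Aᶜ.card = Fintype.card Λ := Finset.card_add_card_compl A
  have hWmax : A.card * n + Aᶜ.card * n = Fintype.card Λ * n := by rw [← hcardΛ, add_mul]
  have hcast : ((Fintype.card Λ * n : ℕ) : ℝ) = (A.card : ℝ) * n + (Aᶜ.card : ℝ) * n := by
    rw [← hcardΛ]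
    push_cast
    ring
  have hbn : Aᶜ.card * n ≤ A.card * n := Nat.mul_le_mul_right n hcard
  have hS₀ : liebMattisSpin n A = ((Fintype.card Λ * n : ℕ) : ℝ) / 2 - (Aᶜ.card * n : ℕ) := by
    have hle : (Aᶜ.card : ℝ) ≤ A.card := by exact_mod_cast hcard
    rw [liebMattisSpin, abs_of_nonneg (by linarith), hcast]
    push_cast
    ring
  -- the family of sector ground states `ψ_W`, `W = N₀ + i`, `i ≤ N₁ - N₀`
  set K : ℕ := A.card * n - Aᶜ.card * n with hK
  have hfam : ∀ i : Fin (K + 1), ∃ ψ ∈ spinZSector (Λ := Λ) n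
      (((Fintype.card Λ * n : ℕ) : ℝ) / 2 - (Aᶜ.card * n + i : ℕ)), ψ ≠ 0 ∧
      heisenbergHamiltonian n G J *ᵥ ψ =
        ((lowestEnergyInSector n (heisenbergHamiltonian n G J)
          (((Fintype.card Λ * n : ℕ) : ℝ) / 2 - (Aᶜ.card * n + i : ℕ)) : ℝ) : ℂ) • ψ := fun i =>
    (sector_perronFrobenius n G J A hG hA hJ (Aᶜ.card * n + i)
      (exists_weight_eq n _ (by have := i.isLt; rw [← hWmax]; omega))).1
  choose ψf hψf_mem hψf_ne hψf_eig using hfam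
  have hbetween : ∀ i : Fin (K + 1),
      lowestEnergyInSector n (heisenbergHamiltonian n G J)
          (((Fintype.card Λ * n : ℕ) : ℝ) / 2 - (Aᶜ.card * n + i : ℕ)) =
        (heisenbergHamiltonian n G J).groundEnergy ∧
      totalSpinSq n *ᵥ ψf i =
        ((((((Fintype.card Λ * n : ℕ) : ℝ) / 2 - (Aᶜ.card * n : ℕ)) *
            (((Fintype.card Λ * n : ℕ) : ℝ) / 2 - (Aᶜ.card * n : ℕ)) +
            (((Fintype.card Λ * n : ℕ) : ℝ) / 2 - (Aᶜ.card * n : ℕ)) : ℝ)) : ℂ) • ψf i := by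
    intro i
    have := i.isLt
    obtain ⟨hE, hS⟩ := sector_between n G J A hG hA hJ hcard (Aᶜ.card * n + i) (by omega) (by omega)
    exact ⟨hE, hS _ (hψf_mem i) (hψf_eig i)⟩
  -- the ground space is spanned by the family
  have hspan : (heisenbergHamiltonian n G J).groundSpace = Submodule.span ℂ (Set.range ψf) := by
    apply le_antisymm
    · intro Φ hΦ
      rw [Matrix.mem_groundSpace_iff] at hΦ
      rw [← sum_components n Φ]
      refine Submodule.sum_mem _ fun W hW => ?_
      by_cases h0 : (fun σ : TensorIndex Λ (n + 1) => if (∑ z, (σ z : ℕ)) = W then Φ σ else 0) = 0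
      · rw [h0]
        exact Submodule.zero_mem _
      have hWle : W ≤ Fintype.card Λ * n := Nat.lt_succ_iff.1 (Finset.mem_range.1 hW)
      have hcomp := heisenbergHamiltonian_mulVec_component n G J hΦ W
      have hEW := lowestEnergyInSector_eq_groundEnergy_of_eigenvector n G J W (component_mem n Φ W) h0 hcomp
      have h1 : Aᶜ.card * n ≤ W := by
        by_contra h
        exact lowestEnergyInSector_ne_groundEnergy_of_lt n G J A hG hA hJ hcard W (by omega) hEW
      have h2 : W ≤ A.card * n := by
        by_contra h
        exact lowestEnergyInSector_ne_groundEnergy_of_gt n G J A hG hA hJ hcard W (by omega) hWle hEW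
      set i : Fin (K + 1) := ⟨W - Aᶜ.card * n, by omega⟩ with hi
      have hWi : Aᶜ.card * n + (i : ℕ) = W := by simp only [hi]; omega
      obtain ⟨-, -, huniq, -⟩ := sector_perronFrobenius n G J A hG hA hJ W (exists_weight_eq n _ hWle)
      have hmem_i := hψf_mem i
      have heig_i := hψf_eig i
      rw [hWi] at hmem_i heig_i
      rw [← hEW] at hcomp
      obtain ⟨c, hc⟩ := huniq (ψf i) _ hmem_i (component_mem n Φ W) heig_i hcomp (hψf_ne i)
      rw [hc]
      exact Submodule.smul_mem _ c (Submodule.subset_span ⟨i, rfl⟩)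
    · rw [Submodule.span_le]
      rintro _ ⟨i, rfl⟩
      rw [SetLike.mem_coe, Matrix.mem_groundSpace_iff, hψf_eig i, (hbetween i).1]
  -- the family is linearly independent (disjoint supports)
  have hli : LinearIndependent ℂ ψf := by
    rw [Fintype.linearIndependent_iff]
    intro g hg i
    obtain ⟨σ, hσ⟩ := Function.ne_iff.1 (hψf_ne i)
    have hσw : (∑ z, (σ z : ℕ)) = Aᶜ.card * n + i := by
      by_contra h
      exact hσ ((mem_spinZSector_weight_iff n _ (ψf i)).1 (hψf_mem i) σ h)
    have h1 := congrFun hg σ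
    rw [Finset.sum_apply, Pi.zero_apply, Finset.sum_eq_single i] at h1
    · rw [Pi.smul_apply, smul_eq_mul] at h1
      rcases mul_eq_zero.1 h1 with h | h
      · exact h
      · exact absurd h hσ
    · intro j _ hji
      rw [Pi.smul_apply, smul_eq_mul, (mem_spinZSector_weight_iff n _ (ψf j)).1 (hψf_mem j) σ, mul_zero]
      rw [hσw]
      intro h
      exact hji (Fin.ext (by omega))
    · intro h
      exact absurd (mem_univ i) h
  refine ⟨fun Φ hΦ => ?_, ?_⟩
  · -- clause 1: the ground space lies in the `S₀(S₀+1)` eigenspace of `(𝐒_tot)²`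
    obtain ⟨-, hΦ⟩ := (Matrix.isGroundStateVector_iff _ Φ).1 hΦ
    rw [hspan] at hΦ
    have hle : Submodule.span ℂ (Set.range ψf) ≤
        Module.End.eigenspace (Matrix.toLin' (totalSpinSq (Λ := Λ) n))
          ((((((Fintype.card Λ * n : ℕ) : ℝ) / 2 - (Aᶜ.card * n : ℕ)) *
            (((Fintype.card Λ * n : ℕ) : ℝ) / 2 - (Aᶜ.card * n : ℕ)) +
            (((Fintype.card Λ * n : ℕ) : ℝ) / 2 - (Aᶜ.card * n : ℕ)) : ℝ)) : ℂ) := by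
      rw [Submodule.span_le]
      rintro _ ⟨i, rfl⟩
      rw [SetLike.mem_coe, Module.End.mem_eigenspace_iff, Matrix.toLin'_apply]
      exact (hbetween i).2
    have h := Module.End.mem_eigenspace_iff.1 (hle hΦ)
    rw [Matrix.toLin'_apply] at h
    rw [h, hS₀]
    push_cast
    ring_nf
  · -- clause 2: the degeneracy is the size of the family
    rw [Matrix.groundStateDegeneracy, hspan, finrank_span_eq_card hli, Fintype.card_fin, hS₀, hK,
      Nat.cast_add, Nat.cast_sub hbn, hcast]
    push_cast
    ring

end QLattice

end LiebMattis

/-! ### The discharge -/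

section LiebMattis

variable {Λ : Type*} [Fintype Λ] [DecidableEq Λ]
variable (n : ℕ) (G : SimpleGraph Λ) [DecidableRel G.Adj] (A : Finset Λ) (J : ℝ)

/-- **Discharge of `marshall_lieb_mattis_spin` (Lieb–Mattis theorem, spin of the ground state).**
For the spin-`n/2` Heisenberg antiferromagnet (`J > 0`) on a finite connected graph bipartite in
`A`, `Aᶜ`, every ground state has total spin `S₀ = |(|A| - |Aᶜ|)| n/2`, i.e.
`(𝐒_tot)² ψ = S₀(S₀+1) ψ`, and the ground-state degeneracy is exactly `2S₀ + 1`. The case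
`|Aᶜ| ≤ |A|` is `LiebMattis.marshall_lieb_mattis_spin_of_card_le`; the other case follows by the
symmetry `A ↔ Aᶜ`. E. Lieb, D. Mattis, J. Math. Phys. 3 (1962) 749, Theorem 2 and its proof;
W. Marshall, Proc. Roy. Soc. A 232 (1955) 48; Tasaki (2020) §2.4, Theorem 2.3; Mattis (2006)
§5.10, pp. 230–231. [cite: LiebMattis1962, Theorem 2] -/
theorem marshall_lieb_mattis_spin_holds : marshall_lieb_mattis_spin n G A J := by
  intro hG hA hJ
  by_cases hcard : Aᶜ.card ≤ A.card
  · exact LiebMattis.marshall_lieb_mattis_spin_of_card_le n G J A hG hA hJ hcard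
  · have hA' : G.IsBipartiteWith ((Aᶜ : Finset Λ) : Set Λ) (↑(Aᶜ : Finset Λ))ᶜ := by
      rw [Finset.coe_compl, compl_compl]
      exact hA.symm
    have hcard' : (Aᶜ : Finset Λ)ᶜ.card ≤ (Aᶜ : Finset Λ).card := by
      rw [compl_compl]
      omega
    have hspin : liebMattisSpin n Aᶜ = liebMattisSpin n A := by
      rw [liebMattisSpin, liebMattisSpin, compl_compl, abs_sub_comm]
    have h := LiebMattis.marshall_lieb_mattis_spin_of_card_le n G J Aᶜ hG hA' hJ hcard'
    rw [hspin] at h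
    exact h

end LiebMattis

end Literature.MathematicalPhysics.QuantumLattice
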